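import Summits.CriticalPhenomena.PercolationContinuityZ3.Theses.PercExchangeRateTransport
import Summits.CriticalPhenomena.PercolationContinuityZ3.Theorems.ModelFacts.Negative.ClosedSquareEdges
import Summits.CriticalPhenomena.PercolationContinuityZ3.Theorems.PercExchangeRateTransportModelFactsStubPushforward
import Summits.CriticalPhenomena.PercolationContinuityZ3.Theorems.PercExchangeRateTransportModelFactsStubPivotalPos
import Literature.Probability.Percolation.ProdBernoulliRusso

/-!
# `ModelFacts` (crux stmt-CriticalPhenomena-16064, route `PercExchangeRateTransport`):
# the fourth edge `t = 0` of clause (8) is NOT load-bearing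

Companion of `Negative/DerivPosGuard.lean` (`n = 0`) and `Negative/ClosedSquareEdges.lean`
(edges `p = 1`, `p = 0`, `t = 1`), completing the census of the guards of clause (8)
(`0 < ∂_pΘ_n` for `1 ≤ n`, `(p,t) ∈ (0,1)²`) of the crux: the guard `0 < t` is REMOVABLE —
`clause8_holds_at_t_zero : 0 < deriv (fun q => Θ_n q 0) p` for `n ≥ 1`, `0 < p < 1`.
Nothing here asserts the crux; this is the "hypothesis unnecessary" half of the disprover's
load-bearing analysis, made a theorem.  Def- and notation-free (the crux's `vert`, `cfg`, `Θ` and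
the slice's parameter field `H.indicator (projIcc b)` are written out literally).

At `t = 0` almost surely no vertical bond is open (labels are a.s. `> 0`), so the slice is
thresholding i.i.d. labels at the constant level `q` on the HORIZONTAL lattice bonds
`H = {e ∈ E(ℤ³) | e not vertical}`; by the landed keystone `stub_pushforward` (p165705) its law is
`prodBernoulli (H.indicator (projIcc q))`, a one-parameter `prodBernoulli` path with coordinate
derivative `1` on `H` and `0` off `H`.  The tree's Russo formula (`hasDerivAt_prodBernoulli_real`)
then writes `∂_pΘ_n(p,0)` as a sum of nonnegative pivotal intensities, bounded below by the term
of `e₀ = s(0,e_x)`, which dominates the probability of the cylinder "x-ray beyond `e_x` open,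
every other pair of `Λ_n` closed" (`PivotalPos.localCylinder_subset_pivotal`, landed p166253) —
positive because the cylinder only needs positive parameters ON THE `x`-RAY (`= p`) and
parameters `< 1` elsewhere (`p` or `0`).  (Grimmett 1999, §2.4, finite energy.)
-/

noncomputable section

open MeasureTheory Filter Topology
open Literature.Probability.Percolation Literature.Probability.LatticeModels
open Literature.Probability.Percolation.DCT16

namespace Summit.CriticalPhenomena.PercolationContinuityZ3.Theorems.ModelFacts.Negative

/-! ## The `t = 0` slice is horizontal thresholding, almost surely -/

/-- Off the null set `{∃ e, U_e ≤ 0}`, the `t = 0` configuration is the horizontal threshold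
configuration. [folklore] -/
theorem cfg_t0_eq_of_pos {U : Sym2 (Site 3) → ℝ} (hU : ∀ e, 0 < U e) (q : ℝ) :
    {e | e ∈ (zdGraph 3).edgeSet ∧ (((∃ x : Site 3, e = s(x, x + Pi.single (2 : Fin 3) 1)) ∧ U e ≤ 0) ∨ (¬ (∃ x : Site 3, e = s(x, x + Pi.single (2 : Fin 3) 1)) ∧ U e ≤ q))} = {e | e ∈ {e : Sym2 (Site 3) | e ∈ (zdGraph 3).edgeSet ∧ ¬ (∃ x : Site 3, e = s(x, x + Pi.single (2 : Fin 3) 1))} ∧ U e ≤ q} := by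
  ext e
  simp only [Set.mem_setOf_eq]
  constructor
  · rintro ⟨he, ⟨-, h0⟩ | ⟨hv, hq⟩⟩
    · exact ((not_le.2 (hU e)) h0).elim
    · exact ⟨⟨he, hv⟩, hq⟩
  · rintro ⟨⟨he, hv⟩, hq⟩
    exact ⟨he, Or.inr ⟨hv, hq⟩⟩

/-- Thresholding maps are measurable (pattern `measurable_configOfLabels`). [folklore] -/
theorem measurable_threshold_const (E : Set (Sym2 (Site 3))) (q : ℝ) :
    Measurable fun U : Sym2 (Site 3) → ℝ => {e | e ∈ E ∧ U e ≤ q} :=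
  measurable_set_iff.2 fun e =>
    (show Measurable fun s : ℝ => (e ∈ E ∧ s ≤ q) from
      measurable_const.and (measurableSet_setOf.1 measurableSet_Iic)).comp (measurable_pi_apply e)

/-- **`Θ_n(q,0)` is a one-parameter `prodBernoulli` probability on the horizontal bonds**
(a.s. identification + landed `stub_pushforward`). [folklore] -/
theorem theta_t0_eq_prodBernoulli (n : ℕ) (q : ℝ) :
    (labelMeasure (Site 3)).real {U : Sym2 (Site 3) → ℝ | {e | e ∈ (zdGraph 3).edgeSet ∧ (((∃ x : Site 3, e = s(x, x + Pi.single (2 : Fin 3) 1)) ∧ U e ≤ 0) ∨ (¬ (∃ x : Site 3, e = s(x, x + Pi.single (2 : Fin 3) 1)) ∧ U e ≤ q))} ∈ siteToBoundary 3 n} = (prodBernoulli (Set.indicator {e : Sym2 (Site 3) | e ∈ (zdGraph 3).edgeSet ∧ ¬ (∃ x : Site 3, e = s(x, x + Pi.single (2 : Fin 3) 1))} (fun _ : Sym2 (Site 3) => Set.projIcc (0 : ℝ) 1 zero_le_one q))).real (siteToBoundary 3 n) := by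
  have h1 : (labelMeasure (Site 3)).real {U : Sym2 (Site 3) → ℝ | {e | e ∈ (zdGraph 3).edgeSet ∧ (((∃ x : Site 3, e = s(x, x + Pi.single (2 : Fin 3) 1)) ∧ U e ≤ 0) ∨ (¬ (∃ x : Site 3, e = s(x, x + Pi.single (2 : Fin 3) 1)) ∧ U e ≤ q))} ∈ siteToBoundary 3 n} =
      (labelMeasure (Site 3)).real {U : Sym2 (Site 3) → ℝ | {e | e ∈ {e : Sym2 (Site 3) | e ∈ (zdGraph 3).edgeSet ∧ ¬ (∃ x : Site 3, e = s(x, x + Pi.single (2 : Fin 3) 1))} ∧ U e ≤ q} ∈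
        siteToBoundary 3 n} := by
    refine measureReal_congr ?_
    filter_upwards [ae_label_pos] with U hU
    show ({e | e ∈ (zdGraph 3).edgeSet ∧ (((∃ x : Site 3, e = s(x, x + Pi.single (2 : Fin 3) 1)) ∧ U e ≤ 0) ∨ (¬ (∃ x : Site 3, e = s(x, x + Pi.single (2 : Fin 3) 1)) ∧ U e ≤ q))} ∈ siteToBoundary 3 n) = ({e | e ∈ {e : Sym2 (Site 3) | e ∈ (zdGraph 3).edgeSet ∧ ¬ (∃ x : Site 3, e = s(x, x + Pi.single (2 : Fin 3) 1))} ∧ U e ≤ q} ∈ siteToBoundary 3 n)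
    rw [cfg_t0_eq_of_pos hU q]
  have hmap : (labelMeasure (Site 3)).map (fun U : Sym2 (Site 3) → ℝ => {e | e ∈ {e : Sym2 (Site 3) | e ∈ (zdGraph 3).edgeSet ∧ ¬ (∃ x : Site 3, e = s(x, x + Pi.single (2 : Fin 3) 1))} ∧ U e ≤ q})
      = prodBernoulli (Set.indicator {e : Sym2 (Site 3) | e ∈ (zdGraph 3).edgeSet ∧ ¬ (∃ x : Site 3, e = s(x, x + Pi.single (2 : Fin 3) 1))} (fun _ : Sym2 (Site 3) => Set.projIcc (0 : ℝ) 1 zero_le_one q)) :=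
    Summit.CriticalPhenomena.PercolationContinuityZ3.Theorems.ModelFacts.stub_pushforward {e : Sym2 (Site 3) | e ∈ (zdGraph 3).edgeSet ∧ ¬ (∃ x : Site 3, e = s(x, x + Pi.single (2 : Fin 3) 1))} fun _ => q
  rw [h1, measureReal_def, measureReal_def, ← hmap,
    Measure.map_apply (measurable_threshold_const _ q) (measurableSet_siteToBoundary 3 n)]
  rfl

/-! ## The one-parameter path `b ↦ HPar(b)` -/

/-- The slice parameter is `projIcc b` on horizontal lattice bonds. [folklore] -/
theorem hpar_of_mem {e : Sym2 (Site 3)} (he : e ∈ {e : Sym2 (Site 3) | e ∈ (zdGraph 3).edgeSet ∧ ¬ (∃ x : Site 3, e = s(x, x + Pi.single (2 : Fin 3) 1))}) (b : ℝ) :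
    (Set.indicator {e : Sym2 (Site 3) | e ∈ (zdGraph 3).edgeSet ∧ ¬ (∃ x : Site 3, e = s(x, x + Pi.single (2 : Fin 3) 1))} (fun _ : Sym2 (Site 3) => Set.projIcc (0 : ℝ) 1 zero_le_one b)) e = Set.projIcc (0 : ℝ) 1 zero_le_one b :=
  Set.indicator_of_mem he _

/-- The slice parameter is `0` off the horizontal lattice bonds. [folklore] -/
theorem hpar_of_not_mem {e : Sym2 (Site 3)} (he : e ∉ {e : Sym2 (Site 3) | e ∈ (zdGraph 3).edgeSet ∧ ¬ (∃ x : Site 3, e = s(x, x + Pi.single (2 : Fin 3) 1))}) (b : ℝ) : (Set.indicator {e : Sym2 (Site 3) | e ∈ (zdGraph 3).edgeSet ∧ ¬ (∃ x : Site 3, e = s(x, x + Pi.single (2 : Fin 3) 1))} (fun _ : Sym2 (Site 3) => Set.projIcc (0 : ℝ) 1 zero_le_one b)) e = 0 :=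
  Set.indicator_of_notMem he _

/-- Coordinate derivative `1` on horizontal bonds, at an interior `p`. [folklore] -/
theorem hasDerivAt_hpar_mem {e : Sym2 (Site 3)} (he : e ∈ {e : Sym2 (Site 3) | e ∈ (zdGraph 3).edgeSet ∧ ¬ (∃ x : Site 3, e = s(x, x + Pi.single (2 : Fin 3) 1))}) {p : ℝ}
    (hp : p ∈ Set.Ioo (0 : ℝ) 1) : HasDerivAt (fun b : ℝ => ((Set.indicator {e : Sym2 (Site 3) | e ∈ (zdGraph 3).edgeSet ∧ ¬ (∃ x : Site 3, e = s(x, x + Pi.single (2 : Fin 3) 1))} (fun _ : Sym2 (Site 3) => Set.projIcc (0 : ℝ) 1 zero_le_one b)) e : ℝ)) 1 p := by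
  have heq : (fun b : ℝ => b) =ᶠ[𝓝 p] fun b : ℝ => ((Set.indicator {e : Sym2 (Site 3) | e ∈ (zdGraph 3).edgeSet ∧ ¬ (∃ x : Site 3, e = s(x, x + Pi.single (2 : Fin 3) 1))} (fun _ : Sym2 (Site 3) => Set.projIcc (0 : ℝ) 1 zero_le_one b)) e : ℝ) := by
    filter_upwards [Ioo_mem_nhds hp.1 hp.2] with b hb
    rw [hpar_of_mem he, Set.projIcc_of_mem _ (Set.Ioo_subset_Icc_self hb)]
  exact (hasDerivAt_id p).congr_of_eventuallyEq heq.symm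

/-- Coordinate derivative `0` off the horizontal bonds. [folklore] -/
theorem hasDerivAt_hpar_not_mem {e : Sym2 (Site 3)} (he : e ∉ {e : Sym2 (Site 3) | e ∈ (zdGraph 3).edgeSet ∧ ¬ (∃ x : Site 3, e = s(x, x + Pi.single (2 : Fin 3) 1))}) (p : ℝ) :
    HasDerivAt (fun b : ℝ => ((Set.indicator {e : Sym2 (Site 3) | e ∈ (zdGraph 3).edgeSet ∧ ¬ (∃ x : Site 3, e = s(x, x + Pi.single (2 : Fin 3) 1))} (fun _ : Sym2 (Site 3) => Set.projIcc (0 : ℝ) 1 zero_le_one b)) e : ℝ)) 0 p := by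
  have hfun : (fun b : ℝ => ((Set.indicator {e : Sym2 (Site 3) | e ∈ (zdGraph 3).edgeSet ∧ ¬ (∃ x : Site 3, e = s(x, x + Pi.single (2 : Fin 3) 1))} (fun _ : Sym2 (Site 3) => Set.projIcc (0 : ℝ) 1 zero_le_one b)) e : ℝ)) = fun _ => (0 : ℝ) := by
    funext b; rw [hpar_of_not_mem he]; rfl
  rw [hfun]
  exact hasDerivAt_const _ _

/-- Every parameter of the slice is `< 1` for `p < 1`. [folklore] -/
theorem hpar_lt_one {p : ℝ} (hp : p ∈ Set.Ioo (0 : ℝ) 1) (e : Sym2 (Site 3)) :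
    ((Set.indicator {e : Sym2 (Site 3) | e ∈ (zdGraph 3).edgeSet ∧ ¬ (∃ x : Site 3, e = s(x, x + Pi.single (2 : Fin 3) 1))} (fun _ : Sym2 (Site 3) => Set.projIcc (0 : ℝ) 1 zero_le_one p)) e : ℝ) < 1 := by
  by_cases he : e ∈ {e : Sym2 (Site 3) | e ∈ (zdGraph 3).edgeSet ∧ ¬ (∃ x : Site 3, e = s(x, x + Pi.single (2 : Fin 3) 1))}
  · rw [hpar_of_mem he, Set.projIcc_of_mem _ (Set.Ioo_subset_Icc_self hp)]
    exact hp.2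
  · rw [hpar_of_not_mem he]
    exact zero_lt_one

/-- The `x`-ray bonds are horizontal lattice bonds, so their parameter is `p > 0`. [folklore] -/
theorem hpar_xray_pos {p : ℝ} (hp : p ∈ Set.Ioo (0 : ℝ) 1) (k : ℕ) :
    0 < ((Set.indicator {e : Sym2 (Site 3) | e ∈ (zdGraph 3).edgeSet ∧ ¬ (∃ x : Site 3, e = s(x, x + Pi.single (2 : Fin 3) 1))} (fun _ : Sym2 (Site 3) => Set.projIcc (0 : ℝ) 1 zero_le_one p)) s((Pi.single (0 : Fin 3) (k : ℤ) : Site 3),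
      Pi.single (0 : Fin 3) ((k + 1 : ℕ) : ℤ)) : ℝ) := by
  rw [hpar_of_mem ⟨(SimpleGraph.mem_edgeSet _).2 (axis_adj_succ 0 k), not_vert_axis_zero k⟩,
    Set.projIcc_of_mem _ (Set.Ioo_subset_Icc_self hp)]
  exact hp.1

/-- The cylinder "x-ray beyond `e_x` open, all other pairs of `Λ_n` closed" has positive
probability under the slice: only the `x`-ray parameters need to be positive. [folklore] -/
theorem cylinder_t0_pos {p : ℝ} (hp : p ∈ Set.Ioo (0 : ℝ) 1) (n : ℕ) :
    0 < (prodBernoulli (Set.indicator {e : Sym2 (Site 3) | e ∈ (zdGraph 3).edgeSet ∧ ¬ (∃ x : Site 3, e = s(x, x + Pi.single (2 : Fin 3) 1))} (fun _ : Sym2 (Site 3) => Set.projIcc (0 : ℝ) 1 zero_le_one p))).real (localCylinder (↑((box 3 n).sym2) : Set (Sym2 (Site 3)))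
        {e | ∃ k : ℕ, 1 ≤ k ∧ k < n ∧
          e = s((Pi.single (0 : Fin 3) (k : ℤ) : Site 3),
            Pi.single (0 : Fin 3) ((k + 1 : ℕ) : ℤ))}) := by
  classical
  rw [Literature.Probability.Percolation.prodBernoulli_real_localCylinder]
  refine Finset.prod_pos fun e _ => ?_
  split_ifs with he
  · obtain ⟨k, -, -, rfl⟩ := he
    exact hpar_xray_pos hp k
  · exact sub_pos.2 (hpar_lt_one hp e)

/-- `e₀ = s(0, e_x)` is a horizontal lattice bond. [folklore] -/
theorem e0_mem_horiz : s((0 : Site 3), Pi.single (0 : Fin 3) 1) ∈ {e : Sym2 (Site 3) | e ∈ (zdGraph 3).edgeSet ∧ ¬ (∃ x : Site 3, e = s(x, x + Pi.single (2 : Fin 3) 1))} := by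
  have h := not_vert_axis_zero 0
  have he := (SimpleGraph.mem_edgeSet (zdGraph 3)).2 (axis_adj_succ 0 0)
  simp only [Nat.cast_zero, Pi.single_zero, zero_add, Nat.cast_one] at h he
  exact ⟨he, h⟩

/-! ## Clause (8) on the edge `t = 0` -/

/-- **Clause (8) of `ModelFacts` survives on the edge `t = 0`** — the guard `0 < t` is NOT
load-bearing: `0 < ∂_pΘ_n(p,0)` for `n ≥ 1`, `0 < p < 1`.  Russo along `b ↦ HPar(b)`
(`hasDerivAt_prodBernoulli_real`), the sum bounded below by the `e₀`-term, which dominates the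
positive cylinder probability (`PivotalPos.localCylinder_subset_pivotal`). [folklore] -/
theorem clause8_holds_at_t_zero (n : ℕ) (hn : 1 ≤ n) (p : ℝ) (hp : p ∈ Set.Ioo (0 : ℝ) 1) :
    0 < deriv (fun q : ℝ => (labelMeasure (Site 3)).real {U : Sym2 (Site 3) → ℝ | {e | e ∈ (zdGraph 3).edgeSet ∧ (((∃ x : Site 3, e = s(x, x + Pi.single (2 : Fin 3) 1)) ∧ U e ≤ 0) ∨ (¬ (∃ x : Site 3, e = s(x, x + Pi.single (2 : Fin 3) 1)) ∧ U e ≤ q))} ∈ siteToBoundary 3 n}) p := by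
  classical
  have hfun : (fun q : ℝ => (labelMeasure (Site 3)).real {U : Sym2 (Site 3) → ℝ | {e | e ∈ (zdGraph 3).edgeSet ∧ (((∃ x : Site 3, e = s(x, x + Pi.single (2 : Fin 3) 1)) ∧ U e ≤ 0) ∨ (¬ (∃ x : Site 3, e = s(x, x + Pi.single (2 : Fin 3) 1)) ∧ U e ≤ q))} ∈ siteToBoundary 3 n}) =
      fun q => (prodBernoulli (Set.indicator {e : Sym2 (Site 3) | e ∈ (zdGraph 3).edgeSet ∧ ¬ (∃ x : Site 3, e = s(x, x + Pi.single (2 : Fin 3) 1))} (fun _ : Sym2 (Site 3) => Set.projIcc (0 : ℝ) 1 zero_le_one q))).real (siteToBoundary 3 n) :=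
    funext fun q => theta_t0_eq_prodBernoulli n q
  let p' : Sym2 (Site 3) → ℝ := fun e => if e ∈ {e : Sym2 (Site 3) | e ∈ (zdGraph 3).edgeSet ∧ ¬ (∃ x : Site 3, e = s(x, x + Pi.single (2 : Fin 3) 1))} then 1 else 0
  have hp'1 : ∀ e, e ∈ {e : Sym2 (Site 3) | e ∈ (zdGraph 3).edgeSet ∧ ¬ (∃ x : Site 3, e = s(x, x + Pi.single (2 : Fin 3) 1))} → p' e = 1 := fun e he => by
    simp only [p']; rw [if_pos he]
  have hp'0 : ∀ e, e ∉ {e : Sym2 (Site 3) | e ∈ (zdGraph 3).edgeSet ∧ ¬ (∃ x : Site 3, e = s(x, x + Pi.single (2 : Fin 3) 1))} → p' e = 0 := fun e he => by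
    simp only [p']; rw [if_neg he]
  have hp'nn : ∀ e, 0 ≤ p' e := fun e => by
    simp only [p']; split_ifs <;> norm_num
  have hderiv : ∀ e ∈ (box 3 n).sym2, HasDerivAt (fun b : ℝ => ((Set.indicator {e : Sym2 (Site 3) | e ∈ (zdGraph 3).edgeSet ∧ ¬ (∃ x : Site 3, e = s(x, x + Pi.single (2 : Fin 3) 1))} (fun _ : Sym2 (Site 3) => Set.projIcc (0 : ℝ) 1 zero_le_one b)) e : ℝ)) (p' e) p := by
    intro e _
    by_cases he : e ∈ {e : Sym2 (Site 3) | e ∈ (zdGraph 3).edgeSet ∧ ¬ (∃ x : Site 3, e = s(x, x + Pi.single (2 : Fin 3) 1))}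
    · rw [hp'1 e he]; exact hasDerivAt_hpar_mem he hp
    · rw [hp'0 e he]; exact hasDerivAt_hpar_not_mem he p
  have hR := hasDerivAt_prodBernoulli_real (fun b : ℝ => (Set.indicator {e : Sym2 (Site 3) | e ∈ (zdGraph 3).edgeSet ∧ ¬ (∃ x : Site 3, e = s(x, x + Pi.single (2 : Fin 3) 1))} (fun _ : Sym2 (Site 3) => Set.projIcc (0 : ℝ) 1 zero_le_one b)))
    (isUpperSet_siteToBoundary 3 n) (determinedBy_siteToBoundary 3 n) p p' hderiv
  rw [hfun, hR.deriv]
  have hnn : ∀ e ∈ (box 3 n).sym2, 0 ≤ p' e *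
      (prodBernoulli (Set.indicator {e : Sym2 (Site 3) | e ∈ (zdGraph 3).edgeSet ∧ ¬ (∃ x : Site 3, e = s(x, x + Pi.single (2 : Fin 3) 1))} (fun _ : Sym2 (Site 3) => Set.projIcc (0 : ℝ) 1 zero_le_one p))).real {ω | IsPivotal (siteToBoundary 3 n) e ω} :=
    fun e _ => mul_nonneg (hp'nn e) measureReal_nonneg
  refine lt_of_lt_of_le ?_ (Finset.single_le_sum hnn (PivotalPos.e0_mem_sym2_box hn))
  rw [hp'1 _ e0_mem_horiz, one_mul]
  exact (cylinder_t0_pos hp n).trans_le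
    (measureReal_mono (PivotalPos.localCylinder_subset_pivotal hn))

/-- **The crux-literal form**: with the crux's own `let`-prefix, clause (8) holds verbatim at
`t = 0` (outside its stated range `t ∈ Ioo 0 1`). [folklore] -/
theorem modelFacts_derivPos_holds_at_t_zero :
    (let μ := Literature.Probability.Percolation.labelMeasure (Literature.Probability.LatticeModels.Site 3)
     let vert : Sym2 (Literature.Probability.LatticeModels.Site 3) → Prop :=
       fun e => ∃ x : Literature.Probability.LatticeModels.Site 3, e = s(x, x + Pi.single (2 : Fin 3) 1)
     let cfg : ℝ → ℝ → (Sym2 (Literature.Probability.LatticeModels.Site 3) → ℝ) →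
         Set (Sym2 (Literature.Probability.LatticeModels.Site 3)) :=
       fun p t U => {e | e ∈ (Literature.Probability.LatticeModels.zdGraph 3).edgeSet ∧
         ((vert e ∧ U e ≤ t) ∨ (¬ vert e ∧ U e ≤ p))}
     let Θ : ℕ → ℝ → ℝ → ℝ :=
       fun n p t => μ.real {U | cfg p t U ∈ Literature.Probability.Percolation.siteToBoundary 3 n}
     ∀ n : ℕ, 1 ≤ n → ∀ p ∈ Set.Ioo (0 : ℝ) 1, 0 < deriv (fun q => Θ n q 0) p) :=
  fun n hn p hp => clause8_holds_at_t_zero n hn p hp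

end Summit.CriticalPhenomena.PercolationContinuityZ3.Theorems.ModelFacts.Negative

end
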